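import Summits.PneNP.PneNP.Theorems.Sd2BlMachineLegs

/-!
# K1'' machine side (S3), DICTIONARY D1 (generic): the block-split raw legs as a piece structure

Cell pnp-ideate, ROUND-18 item K1'' (file-level split agreed 2026-08-27 22:10Z: prover-2 = raw legs / greedy /
glue, prover-1 = the dictionary twins `Sd2BlMachineDict*` of the CAND files `SfmBlMachineDict*`).  Twin of
`SfmBlMachineDictPieces` with `trips ↦ raw`, generic in the raw-leg list `raw : List RLeg` of
`Sd2BlMachineLegs` (pnp-ideate-prover-2, G1): legs are POSITIONS `Fin raw.length`, the pieced leg of position `i` is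
`plegG L raw i`, the piece types are the left / right LABELS occurring among the pieced legs (`LPieceG`, `RPieceG`),
`srcG / dstG i` = the labels of pieced leg `i`; OWNERS are decoded from the owner codes carried by the labels
(`ownerOfCode n c`: `c = 2·x + b`, vertex code `x = 0` ↦ the constant vertex `none`, `x = v + 1` ↦ `some v`; bit `b`)
(`ownerOfCode_const`, `ownerOfCode_vertex`: the convention «vertex code `0` = constant, `v+1` = variable `v`; code =
`2·(vertex code) + bit`» of the raw-leg builder), so the owner compatibilities `hsrc / hdst` of
`SignDeg2Legs.sigCertified_of_legBound` reduce to «the raw leg carries the codes of its owners»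
(`own₁G_srcG`, `own₂G_dstG`); and the DEGREE BOUNDS `≤ L` of `Sd2Bl.legBound_of_pipeline`
(`card_filter_srcG_le`, `card_filter_dstG_le`, from `length_nbrs_pieceLegsG_le`).  The piece-count bound,
the connectivity transfer and the decomposition clauses are D1b–D2.  Restricted-model algorithmic infrastructure;
nothing here bears on `P` versus `NP`.
-/

set_option linter.dupNamespace false -- `Summit.PneNP.PneNP.…`: summit = sub-problem name (D-0017 single-conjunct layout)

namespace Summit.PneNP.PneNP.Theorems.Sd2BlMachine

open Literature.Computability.Complexity
open Summit.PneNP.PneNP.Theorems.SfmBlMachine (Lab PLeg labL labR nbrs)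

variable {n : ℕ}

/-! ## Owner codes, decoded -/

/-- The owner record of an owner code `c = 2·x + b`: vertex code `x = 0` ↦ `none`, `x = v + 1` ↦ `some v` (junk, i.e.
`v ≥ n`, ↦ `none`); bit `b`. -/
def ownerOfCode (n c : ℕ) : Option (Fin n) × Bool :=
  (if h : 0 < c / 2 ∧ c / 2 - 1 < n then some ⟨c / 2 - 1, h.2⟩ else none, decide (c % 2 = 1))

/-- Decoding the code of a constant owner: `[b] ↦ (none, b)`. -/
theorem ownerOfCode_const (n : ℕ) (b : Bool) : ownerOfCode n b.toNat = (none, b) := by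
  cases b <;> simp [ownerOfCode]

/-- Decoding the code of a vertex owner: `2·(v+1) + [b] ↦ (some v, b)`. -/
theorem ownerOfCode_vertex (v : Fin n) (b : Bool) : ownerOfCode n (2 * (v.val + 1) + b.toNat) = (some v, b) := by
  have hv := v.isLt
  cases b
  · simp only [ownerOfCode, Bool.toNat_false, add_zero, Prod.mk.injEq]
    refine ⟨?_, by simp [Nat.mul_mod_right]⟩
    rw [dif_pos ⟨by omega, by omega⟩]
    congr 1; apply Fin.ext; simp
  · simp only [ownerOfCode, Bool.toNat_true, Prod.mk.injEq]
    refine ⟨?_, by simp⟩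
    rw [dif_pos ⟨by omega, by omega⟩]
    congr 1; apply Fin.ext; show (2 * (v.val + 1) + 1) / 2 - 1 = v.val; omega

/-! ## Legs as positions; pieces as labels -/

variable (L : ℕ) (raw : List RLeg)

/-- The pieced leg of position `i`. -/
def plegOfG (i : Fin raw.length) : PLeg := plegG L raw i.val

/-- The pieced leg of a position is an item of `pieceLegsG`. -/
theorem plegOfG_mem (i : Fin raw.length) : plegOfG L raw i ∈ pieceLegsG L raw :=
  (mem_pieceLegsG_iff L raw _).2 ⟨i.val, i.isLt, rfl⟩

/-- LEFT PIECES: the left labels occurring among the pieced legs. -/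
abbrev LPieceG : Type := {P : Lab // P ∈ (pieceLegsG L raw).map labL}

/-- RIGHT PIECES: the right labels occurring among the pieced legs. -/
abbrev RPieceG : Type := {Q : Lab // Q ∈ (pieceLegsG L raw).map labR}

/-- The left piece of a leg. -/
def srcG (i : Fin raw.length) : LPieceG L raw := ⟨labL (plegOfG L raw i), List.mem_map.2 ⟨_, plegOfG_mem L raw i, rfl⟩⟩

/-- The right piece of a leg. -/
def dstG (i : Fin raw.length) : RPieceG L raw := ⟨labR (plegOfG L raw i), List.mem_map.2 ⟨_, plegOfG_mem L raw i, rfl⟩⟩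

/-- The output of a leg. -/
def outG (i : Fin raw.length) : ℕ := (raw[i.val]).1

/-- The owner of a left piece (decoded from its owner code). -/
def own₁G (n : ℕ) (P : LPieceG L raw) : Option (Fin n) × Bool := ownerOfCode n P.1.2.1

/-- The owner of a right piece (decoded from its owner code). -/
def own₂G (n : ℕ) (Q : RPieceG L raw) : Option (Fin n) × Bool := ownerOfCode n Q.1.2.1

/-- **Compatibility, source side**: the left piece of leg `i` is owned by the decoded left code of raw leg `i`. -/
theorem own₁G_srcG (n : ℕ) (i : Fin raw.length) : own₁G L raw n (srcG L raw i) = ownerOfCode n (raw[i.val]).2.2.1 := by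
  unfold own₁G srcG plegOfG
  simp only [labL_plegG]
  rw [lvertG_eq raw i.val i.isLt]

/-- **Compatibility, target side**: the right piece of leg `i` is owned by the decoded right code of raw leg `i`. -/
theorem own₂G_dstG (n : ℕ) (i : Fin raw.length) : own₂G L raw n (dstG L raw i) = ownerOfCode n (raw[i.val]).2.2.2 := by
  unfold own₂G dstG plegOfG
  simp only [labR_plegG]
  rw [rvertG_eq raw i.val i.isLt]

/-! ## Degree bounds -/

/-- Counting positions by a property of their pieced leg = counting pieced legs. -/
theorem card_filter_pos_eq (p : PLeg → Prop) [DecidablePred p] :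
    (Finset.univ.filter fun i : Fin raw.length => p (plegOfG L raw i)).card = ((pieceLegsG L raw).filter fun x => p x).length := by
  unfold pieceLegsG plegOfG
  rw [← List.map_coe_finRange_eq_range, List.map_map, List.filter_map, List.length_map,
    ← List.toFinset_card_of_nodup ((List.nodup_finRange _).filter _), List.toFinset_filter, List.toFinset_finRange]
  congr 1
  ext i
  simp

/-- **Every left piece carries at most `L` legs.** -/
theorem card_filter_srcG_le {L : ℕ} (hL : 0 < L) (raw : List RLeg) (P : LPieceG L raw) :
    (Finset.univ.filter fun i => srcG L raw i = P).card ≤ L := by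
  have h := card_filter_pos_eq L raw (fun x => labL x = P.1)
  have e : (Finset.univ.filter fun i => srcG L raw i = P) = (Finset.univ.filter fun i : Fin raw.length => labL (plegOfG L raw i) = P.1) := by
    ext i
    simp only [Finset.mem_filter, Finset.mem_univ, true_and, srcG]
    exact ⟨fun h => congrArg Subtype.val h, fun h => Subtype.ext h⟩
  rw [e, h]
  have hn := length_nbrs_pieceLegsG_le hL raw P.1
  unfold nbrs at hn
  rw [List.length_append, List.length_map, List.length_map] at hn
  have : ((pieceLegsG L raw).filter fun x => decide (labL x = P.1)).length ≤ L := by omega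
  convert this using 2

/-- **Every right piece carries at most `L` legs.** -/
theorem card_filter_dstG_le {L : ℕ} (hL : 0 < L) (raw : List RLeg) (Q : RPieceG L raw) :
    (Finset.univ.filter fun i => dstG L raw i = Q).card ≤ L := by
  have h := card_filter_pos_eq L raw (fun x => labR x = Q.1)
  have e : (Finset.univ.filter fun i => dstG L raw i = Q) = (Finset.univ.filter fun i : Fin raw.length => labR (plegOfG L raw i) = Q.1) := by
    ext i
    simp only [Finset.mem_filter, Finset.mem_univ, true_and, dstG]
    exact ⟨fun h => congrArg Subtype.val h, fun h => Subtype.ext h⟩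
  rw [e, h]
  have hn := length_nbrs_pieceLegsG_le hL raw Q.1
  unfold nbrs at hn
  rw [List.length_append, List.length_map, List.length_map] at hn
  have : ((pieceLegsG L raw).filter fun x => decide (labR x = Q.1)).length ≤ L := by omega
  convert this using 2

end Summit.PneNP.PneNP.Theorems.Sd2BlMachine
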